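import Mathlib.Analysis.SpecialFunctions.Pow.Real
import HarnessLib

/-!
# Algebraic certificates for (G1), (G3) and the gadget-state mixture of the CORE REDUCTION (BENCH rows M2-R89 / M2-R90, PROOFS §P66 (c), (e), (f))

Support file (`--supports stmt-CriticalPhenomena-4575`), prover seat `prim-rate-mine-2` (lane prim-rate, constants-miner (c);
`run/shared/lean/prim/prim-rate/prim-rate-mine-2/PROOFS.md` §P65 (g), §P66; BENCH rows l.263 M2-R88, l.264 M2-R89, l.265 M2-R90).
No definitions, no named facts, no sorries; standard axioms.  Pure real-arithmetic lemmas: the three inequality steps of the proof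
that the first-order size-law bracket `P_n = M + C(n)·Cov` is non-negative on the «separator core + {b,u,x}-gadget» class, separated
from the probabilistic identities (PROOFS §P66 (a), (d): closed forms of the two-copy functionals in the side atoms; §P65 (f1): the
three-law decomposition) which feed them.

* **`CSH.coreGadget_G1_alg`** (PROOFS §P66 (c)): with `Φ := λ′·[(1+C+α′)E + (1+C)(1−α′)α₁λ] + D′·[(1+C)λ − E]` (the closed form of
  the spoke functional `R_{xb}(S₀) = N_{xb} + C·K_{xb}` of BENCH l.224 on a separator core), the side facts `0 ≤ E ≤ k_L·λ` (the E-LEMMA,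
  `CSH.oneSideE_le_card_mul`), `0 ≤ D′ ≤ (k_R + α′)·λ′` (K4b, `CSH.cov_conn_le_card_add_mul`), `0 ≤ α₁`, `0 ≤ α′ ≤ 1`, `0 ≤ λ, λ′` and the
  constant condition `k_L·k_R ≤ (1+C)(k_L+k_R)` (true for `C = C(n)`, `n ≥ k_L+k_R+2`) imply `0 ≤ Φ`;
* **`CSH.coreGadget_G3_alg`** (PROOFS §P66 (e)): `E_L·E_R ≤ (1+C)·(λ′E_L + λE_R + λλ′t)` under `0 ≤ E_L ≤ k_Lλ`, `0 ≤ E_R ≤ k_Rλ′`, `0 ≤ t`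
  and the same constant condition — K5's two-line argument with the E-lemma in place of the one-side size lemma;
* **`CSH.coreGadget_mixture_alg`** (PROOFS §P66 (f), l.263's chain): for gadget-state probabilities `p₀, p_bu, p_bx, p_ux, p_all ≥ 0` with
  the gadget Harris inequality `p_bx·p_ux ≤ p_all·(p₀ + p_bu)` and block values with the proved sign pattern (`B₀₀, B_{0,bx}, B_{0,ux},
  B_{0,bu}, B_{bu,bu}, B_{bu,bx}, B_{bu,ux} ≥ 0`, `B_{bx,ux} ≤ 0`, `B_{0,all} + B_{bx,ux} ≥ 0`), the mixture
  `Σ_{γ,γ′} p_γ p_γ′ B_{γγ′}` (with `B_{bu,all} = B_{0,all}` and the five vanishing blocks) is `≥ 0`.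
[cite: VandenbergHaggstromKahn2005, Thm. 1.3 (p. 6)] [cite: Harris1960, Lemma 4.1 (p. 16)]
-/

namespace Summit.CriticalPhenomena.PercolationContinuityZ3.Theorems.CSH

/-- **Certificate for (G1)** (PROOFS §P66 (c)): positivity of the closed form of the spoke functional from the E-lemma on the
spoke-deleted `L` side, K4b on the `R` side and `k_L k_R ≤ (1+C)(k_L+k_R)`. [cite: VandenbergHaggstromKahn2005, Thm. 1.3 (p. 6)] -/
theorem coreGadget_G1_alg {C kL kR E lam a1 D lam' a' : ℝ} (hC : 0 ≤ C) (hkR : 0 ≤ kR)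
    (hE : 0 ≤ E) (hElam : E ≤ kL * lam) (hlam : 0 ≤ lam) (ha1 : 0 ≤ a1) (hD : 0 ≤ D) (hDlam : D ≤ (kR + a') * lam')
    (hlam' : 0 ≤ lam') (ha'0 : 0 ≤ a') (ha'1 : a' ≤ 1) (hK : kL * kR ≤ (1 + C) * (kL + kR)) :
    0 ≤ lam' * ((1 + C + a') * E + (1 + C) * (1 - a') * a1 * lam) + D * ((1 + C) * lam - E) := by
  have h2 : 0 ≤ (1 + C) * (1 - a') * a1 * lam :=
    mul_nonneg (mul_nonneg (mul_nonneg (by linarith) (by linarith)) ha1) hlam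
  by_cases hcase : E ≤ (1 + C) * lam
  · have h1 : 0 ≤ (1 + C + a') * E := mul_nonneg (by linarith) hE
    have h3 : 0 ≤ D * ((1 + C) * lam - E) := mul_nonneg hD (by linarith)
    have h4 : 0 ≤ lam' * ((1 + C + a') * E + (1 + C) * (1 - a') * a1 * lam) := mul_nonneg hlam' (by linarith)
    linarith
  · have hlt : (1 + C) * lam < E := lt_of_not_ge hcase
    -- replace `D` by its upper bound on the (now non-positive) factor
    have h3 : (kR + a') * lam' * ((1 + C) * lam - E) ≤ D * ((1 + C) * lam - E) := by
      have hf : (1 + C) * lam - E ≤ 0 := by linarith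
      have := mul_le_mul_of_nonpos_right hDlam hf
      linarith
    -- the key linear combination is non-negative
    have hkey : 0 ≤ (1 + C - kR) * E + (1 + C) * (kR + a') * lam := by
      have h5 : 0 ≤ (1 + C) * (kR + a') * lam := mul_nonneg (mul_nonneg (by linarith) (by linarith)) hlam
      by_cases hkR' : kR ≤ 1 + C
      · have : 0 ≤ (1 + C - kR) * E := mul_nonneg (by linarith) hE
        linarith
      · have hkRgt : 1 + C < kR := lt_of_not_ge hkR'
        have hneg : (1 + C - kR) * (kL * lam) ≤ (1 + C - kR) * E :=
          mul_le_mul_of_nonpos_left hElam (by linarith)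
        have h7 : 0 ≤ ((1 + C) * (kL + kR) - kL * kR) * lam := mul_nonneg (by linarith) hlam
        have h8 : 0 ≤ (1 + C) * a' * lam := mul_nonneg (mul_nonneg (by linarith) ha'0) hlam
        have h6 : (1 + C - kR) * (kL * lam) + (1 + C) * (kR + a') * lam =
            ((1 + C) * (kL + kR) - kL * kR) * lam + (1 + C) * a' * lam := by ring
        linarith
    have hsum : lam' * ((1 + C + a') * E + (1 + C) * (1 - a') * a1 * lam) + (kR + a') * lam' * ((1 + C) * lam - E) =
        lam' * (((1 + C - kR) * E + (1 + C) * (kR + a') * lam) + (1 + C) * (1 - a') * a1 * lam) := by ring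
    have h4 : 0 ≤ lam' * (((1 + C - kR) * E + (1 + C) * (kR + a') * lam) + (1 + C) * (1 - a') * a1 * lam) :=
      mul_nonneg hlam' (by linarith)
    linarith

/-- **Certificate for (G3)** (PROOFS §P66 (e)): `E_L E_R ≤ (1+C)(λ′E_L + λE_R + λλ′t)` — the two-line argument of the separator
size law K5 with the E-lemma `E ≤ kλ` as the side input. [cite: VandenbergHaggstromKahn2005, Thm. 1.3 (p. 6)] -/
theorem coreGadget_G3_alg {C kL kR EL ER lam lam' t : ℝ} (hC : 0 ≤ C) (hkL : 0 ≤ kL) (hkR : 0 ≤ kR)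
    (hEL : 0 ≤ EL) (hELle : EL ≤ kL * lam) (hER : 0 ≤ ER) (hERle : ER ≤ kR * lam')
    (hlam : 0 ≤ lam) (hlam' : 0 ≤ lam') (ht : 0 ≤ t) (hK : kL * kR ≤ (1 + C) * (kL + kR)) :
    EL * ER ≤ (1 + C) * (lam' * EL + lam * ER + lam * lam' * t) := by
  have h0 : 0 ≤ lam * lam' * t := mul_nonneg (mul_nonneg hlam hlam') ht
  have hC1 : 0 ≤ 1 + C := by linarith
  -- `k_L k_R (λ'E_L + λ E_R) ≥ (k_L + k_R) E_L E_R`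
  have h1 : kL * ER * EL ≤ kL * (kR * lam') * EL := by
    have := mul_nonneg (mul_nonneg hkL hEL) (sub_nonneg.2 hERle)
    have e : kL * (kR * lam') * EL - kL * ER * EL = kL * EL * (kR * lam' - ER) := by ring
    linarith
  have h2 : kR * EL * ER ≤ kR * (kL * lam) * ER := by
    have := mul_nonneg (mul_nonneg hkR hER) (sub_nonneg.2 hELle)
    have e : kR * (kL * lam) * ER - kR * EL * ER = kR * ER * (kL * lam - EL) := by ring
    linarith
  have h3a : (kL + kR) * (EL * ER) ≤ kL * kR * (lam' * EL + lam * ER) := by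
    have e1 : kL * kR * (lam' * EL + lam * ER) - (kL + kR) * (EL * ER) =
        (kL * (kR * lam') * EL - kL * ER * EL) + (kR * (kL * lam) * ER - kR * EL * ER) := by ring
    linarith
  have h3 : (1 + C) * ((kL + kR) * (EL * ER)) ≤ (1 + C) * (kL * kR * (lam' * EL + lam * ER)) :=
    mul_le_mul_of_nonneg_left h3a hC1
  have h4 : kL * kR * (EL * ER) ≤ (1 + C) * (kL + kR) * (EL * ER) :=
    mul_le_mul_of_nonneg_right hK (mul_nonneg hEL hER)
  -- hence `k_L k_R · [(1+C)(λ'E_L + λE_R) − E_L E_R] ≥ 0`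
  have h5 : 0 ≤ kL * kR * ((1 + C) * (lam' * EL + lam * ER) - EL * ER) := by
    have e : kL * kR * ((1 + C) * (lam' * EL + lam * ER) - EL * ER) =
        (1 + C) * (kL * kR * (lam' * EL + lam * ER)) - kL * kR * (EL * ER) := by ring
    have e' : (1 + C) * (kL + kR) * (EL * ER) = (1 + C) * ((kL + kR) * (EL * ER)) := by ring
    rw [e]; rw [e'] at h4; linarith
  have hsplit : (1 + C) * (lam' * EL + lam * ER + lam * lam' * t) =
      (1 + C) * (lam' * EL + lam * ER) + (1 + C) * (lam * lam' * t) := by ring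
  have ht' : 0 ≤ (1 + C) * (lam * lam' * t) := mul_nonneg hC1 h0
  by_cases hz : EL * ER = 0
  · rw [hz, hsplit]
    exact add_nonneg (mul_nonneg hC1 (add_nonneg (mul_nonneg hlam' hEL) (mul_nonneg hlam hER))) ht'
  · have hEL' : 0 < EL := lt_of_le_of_ne hEL (fun h => hz (by rw [← h, zero_mul]))
    have hER' : 0 < ER := lt_of_le_of_ne hER (fun h => hz (by rw [← h, mul_zero]))
    have hkL' : 0 < kL := by
      rcases eq_or_lt_of_le hkL with h | h
      · exfalso; rw [← h, zero_mul] at hELle; linarith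
      · exact h
    have hkR' : 0 < kR := by
      rcases eq_or_lt_of_le hkR with h | h
      · exfalso; rw [← h, zero_mul] at hERle; linarith
      · exact h
    have hprod : 0 < kL * kR := mul_pos hkL' hkR'
    have h6 : 0 ≤ (1 + C) * (lam' * EL + lam * ER) - EL * ER := by
      by_contra hneg
      have hneg' : (1 + C) * (lam' * EL + lam * ER) - EL * ER < 0 := lt_of_not_ge hneg
      have : kL * kR * ((1 + C) * (lam' * EL + lam * ER) - EL * ER) < 0 := mul_neg_of_pos_of_neg hprod hneg'
      linarith
    rw [hsplit]; linarith

/-- **Certificate for the gadget-state mixture** (PROOFS §P66 (f); the chain of BENCH l.263's CORE REDUCTION THEOREM): the symmetric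
mixture `Σ p_γ p_γ′ B_{γγ′}` over the five gadget states `0, bu, bx, ux, all` is non-negative given the proved block signs, the identity
`B_{bu,all} = B_{0,all}`, the five vanishing blocks, (G1) for `B_{0,bx}, B_{0,ux}`, (G3) `B_{0,all} + B_{bx,ux} ≥ 0`, and the gadget Harris
inequality `p_bx p_ux ≤ p_all (p₀ + p_bu)`. [cite: Harris1960, Lemma 4.1 (p. 16)] -/
theorem coreGadget_mixture_alg {p0 pbu pbx pux pall B00 B0bu B0bx B0ux B0all Bbubu Bbubx Bbuux Bbxux : ℝ}
    (hp0 : 0 ≤ p0) (hpbu : 0 ≤ pbu) (hpbx : 0 ≤ pbx) (hpux : 0 ≤ pux) (hpall : 0 ≤ pall)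
    (hH : pbx * pux ≤ pall * (p0 + pbu))
    (h00 : 0 ≤ B00) (h0bu : 0 ≤ B0bu) (h0bx : 0 ≤ B0bx) (h0ux : 0 ≤ B0ux) (hbubu : 0 ≤ Bbubu) (hbubx : 0 ≤ Bbubx)
    (hbuux : 0 ≤ Bbuux) (hbxux : Bbxux ≤ 0) (hG3 : 0 ≤ B0all + Bbxux) :
    0 ≤ p0 * p0 * B00 + 2 * p0 * pbu * B0bu + 2 * p0 * pbx * B0bx + 2 * p0 * pux * B0ux + 2 * p0 * pall * B0all
      + pbu * pbu * Bbubu + 2 * pbu * pbx * Bbubx + 2 * pbu * pux * Bbuux + 2 * pbu * pall * B0all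
      + 2 * pbx * pux * Bbxux := by
  have h1 : 0 ≤ p0 * p0 * B00 := mul_nonneg (mul_nonneg hp0 hp0) h00
  have h2 : 0 ≤ 2 * p0 * pbu * B0bu := by positivity
  have h3 : 0 ≤ 2 * p0 * pbx * B0bx := by positivity
  have h4 : 0 ≤ 2 * p0 * pux * B0ux := by positivity
  have h5 : 0 ≤ pbu * pbu * Bbubu := by positivity
  have h6 : 0 ≤ 2 * pbu * pbx * Bbubx := by positivity
  have h7 : 0 ≤ 2 * pbu * pux * Bbuux := by positivity
  -- the negative block is dominated: 2 pbx pux Bbxux ≥ 2 pall (p0+pbu) Bbxux, and B0all ≥ -Bbxux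
  have h8 : 2 * pbx * pux * Bbxux ≥ 2 * (pall * (p0 + pbu)) * Bbxux := by nlinarith
  have h9 : 2 * p0 * pall * B0all + 2 * pbu * pall * B0all + 2 * (pall * (p0 + pbu)) * Bbxux =
      2 * pall * (p0 + pbu) * (B0all + Bbxux) := by ring
  have h10 : 0 ≤ 2 * pall * (p0 + pbu) * (B0all + Bbxux) := by positivity
  nlinarith

end Summit.CriticalPhenomena.PercolationContinuityZ3.Theorems.CSH
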